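import Summits.HodgeConjecture.CorCM.IrreducibleOddWeightsMaximalAdditive
import HarnessLib

/-!
# One (IRR) slot: `dim U(Σ) = t · dim A`, `t` = the size of ANY maximal independent sub-family = the rank of the type
# vectors over the commutant

COR-CM (cell `pub-hodgecm2`, binder seat `b16` gen 56, count-neutral claim MAX-NONDEG (D-RANK), file F3 — abstract
`G`-set level, sequel of F2 `CorCM/IrreducibleOddWeightsMaximalAdditive` and of seat gen 55's F1/F6
`CorCM/IrreducibleOddWeights{,RankSubsetSum}`; theorems only, no definition, no named fact, no `sorry`).  NEW as
stated, hence under `Summits/`.  HONEST FRAMING: finite-dimensional linear algebra about the Kubota–Dodson rank of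
SAME-SLOT families of CM types (one `G`-set `X`; one CM field `K`, `X = Hom(K, ℂ)`), read on Hodge groups of products
of abelian varieties with complex multiplication by ONE field; `HC_CM` is neither used nor asserted.

SETTING.  `A ≤ ℚ^X` a `G`-stable subspace satisfying (IRR) (every non-zero stable subspace of `A` is `A`; for CM
types `A = Anti`), type vectors `u_i = u_1(Φ_i) ∈ A` (`i ∈ I`).  Seat gen 55: a same-slot family is ADDITIVE iff its
type vectors satisfy NO EQUIVARIANT RELATION (`Σ_i φ_i(u_i) = 0 ⟹ ∀ i, φ_i(u_i) = 0` for `G`-equivariant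
endomorphisms `φ_i` of `ℚ^X`) — independence over the commutant `D = End_G(A)` — and `dim U(Σ) = r · dim A` for SOME
`r ≤ |I|` (F6 `exists_finrank_antiSpan_sigmaType_eq_mul`).  Call a set of slots `T` INDEPENDENT when `(u_i)_{i∈T}`
satisfies no equivariant relation.  This file identifies `r`:

> **Theorem** (`finrank_antiSpan_sigmaType_eq_card_mul_of_maximal`).  For EVERY maximal independent set of slots
> `T`: `dim U(Σ) = |T| · dim A`.  Hence (`card_le_card_of_independent_of_maximal`,
> `card_eq_card_of_maximal`, `card_le_card_of_generated`) all maximal independent sets have the same size `t`, every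
> independent set has at most `t` members, every GENERATING set (one through which all `u_i` are equivariant
> combinations) has at least `t` members — `t` is the rank of `u_1, …, u_k` over the division algebra `D`, read
> without naming `D` — and (`exists_maximal_finrank_antiSpan_sigmaType_eq_card_mul`) such `T` exist.

For CM types of an (IRR) slot (`|X| = 2n`, `dim Anti = n`; `typeRank_sigmaType_eq_card_mul_add_one_of_maximal`):
**`rank(Σ) = t·n + 1`, i.e. `dim Hg(A_1 × ⋯ × A_k) = n·t` with `t` the largest number of the `A_i` forming a
nondegenerate family** — for a (SC)/(M1) field `t` is the number of distinct type vectors up to sign (linear rank);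
for the `SD₁₆`-octics of the numerics (`d = 2`, `n = 4`) `t ≤ 2` for any number of factors.

## References

* [Mai1989] L. Mai, *Lower bounds for the ranks of CM types*, J. Number Theory 32 (1989), §2 Prop. 1 (proof: `rank =
  Σ_π d_π rank π(τ)`).
* [Serre1977] J.-P. Serre, *Linear Representations of Finite Groups*, GTM 42 (1977), §2.2 Prop. 4, §12.2.
* [Gordon1999HodgeAVSurvey] B. B. Gordon, *A survey of the Hodge conjecture for abelian varieties*, §3 Theorem (proof),
  7.5–7.7.
* [Deligne1982HodgeCycles] P. Deligne, *Hodge cycles on abelian varieties*, LNM 900 (1982), I Ex. 3.7 (c).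
-/

set_option autoImplicit false

noncomputable section

open scoped BigOperators

universe u v w

namespace Summit.HodgeConjecture.CorCM.IrrOdd

open Literature.NumberTheory.ComplexMultiplication

variable {G : Type w} [Group G] {I : Type u} {X : Type v} [MulAction G X]

/-! ### §1 Independent sub-families of an (IRR) slot are the additive ones -/

section Independent

variable [DecidableEq I] [Fintype X] {A : Submodule ℚ (X → ℚ)}

/-- **For a sub-family of a same-slot family with type vectors in an (IRR) subspace: additive ⟺ independent** (seat
gen 55's criterion `forall_map_slotExt_le_iff_forall_equivariant`, instantiated on the sub-family `{i // p i}`).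
[cite: Mai1989, §2 Prop. 1 (proof)] [cite: Serre1977, §2.2 Prop. 4] -/
theorem forall_map_slotExt_le_subtype_iff_forall_equivariant
    (hAst : ∀ (k : G) (a : X → ℚ), a ∈ A → (fun x => a (k • x)) ∈ A)
    (hirr : ∀ W : Submodule ℚ (X → ℚ), W ≤ A → W ≠ ⊥ →
      (∀ (k : G) (f : X → ℚ), f ∈ W → (fun y => f (k • y)) ∈ W) → W = A)
    (Φ : I → Set X) (hu : ∀ i, antiVec (Φ i) (1 : G) ∈ A) (p : I → Prop) [Fintype {i // p i}] :
    (∀ j : {i // p i}, (antiSpan G (Φ j.1)).map (slotExt (E := fun _ : {i // p i} => X) j) ≤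
        antiSpan G (sigmaType (E := fun _ : {i // p i} => X) fun j => Φ j.1)) ↔
      ∀ φ : {i // p i} → ((X → ℚ) →ₗ[ℚ] (X → ℚ)),
        (∀ j (g : G) (f : X → ℚ), φ j (fun x => f (g⁻¹ • x)) = fun x => φ j f (g⁻¹ • x)) →
        ∑ j, φ j (antiVec (Φ j.1) (1 : G)) = 0 → ∀ j, φ j (antiVec (Φ j.1) (1 : G)) = 0 :=
  forall_map_slotExt_le_iff_forall_equivariant hAst hirr (fun j : {i // p i} => Φ j.1) fun j => hu j.1

end Independent

/-! ### §2 `dim U(Σ) = |T| · dim A` for every maximal independent `T` -/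

section DRank

variable [DecidableEq I] [Fintype I] [Fintype X] [Nonempty X] {A : Submodule ℚ (X → ℚ)}

/-- **THE `D`-RANK FORMULA.**  Same-slot family with type vectors in an (IRR) subspace `A ≤ ℚ^X`; `T` a set of slots
whose type vectors satisfy NO equivariant relation and which is MAXIMAL with this property (no `i₀ ∉ T` can be
added).  Then `dim U(Σ) = |T| · dim A` (F2: the restriction `U(Σ) → U(Σ|_T)` is an isomorphism, and
`U(Σ|_T) = ⊕_{T} A`).  On Hodge groups of abelian varieties with CM by one (IRR) field: `dim Hg(∏_I A_i) = n · |T|`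
for every maximal nondegenerate sub-collection `T`. [cite: Mai1989, §2 Prop. 1 (proof)] [cite: Serre1977, §2.2 Prop. 4]
[cite: Gordon1999HodgeAVSurvey, §3 Theorem (proof) and 7.5–7.7] -/
theorem finrank_antiSpan_sigmaType_eq_card_mul_of_maximal
    (hAst : ∀ (k : G) (a : X → ℚ), a ∈ A → (fun x => a (k • x)) ∈ A)
    (hirr : ∀ W : Submodule ℚ (X → ℚ), W ≤ A → W ≠ ⊥ →
      (∀ (k : G) (f : X → ℚ), f ∈ W → (fun y => f (k • y)) ∈ W) → W = A)
    (Φ : I → Set X) (hu : ∀ i, antiVec (Φ i) (1 : G) ∈ A) (T : Finset I)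
    (hind : ∀ φ : {i // i ∈ T} → ((X → ℚ) →ₗ[ℚ] (X → ℚ)),
      (∀ j (g : G) (f : X → ℚ), φ j (fun x => f (g⁻¹ • x)) = fun x => φ j f (g⁻¹ • x)) →
      ∑ j, φ j (antiVec (Φ j.1) (1 : G)) = 0 → ∀ j, φ j (antiVec (Φ j.1) (1 : G)) = 0)
    (hmax : ∀ i₀, i₀ ∉ T → ¬ ∀ φ : {i // i ∈ T ∨ i = i₀} → ((X → ℚ) →ₗ[ℚ] (X → ℚ)),
      (∀ j (g : G) (f : X → ℚ), φ j (fun x => f (g⁻¹ • x)) = fun x => φ j f (g⁻¹ • x)) →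
      ∑ j, φ j (antiVec (Φ j.1) (1 : G)) = 0 → ∀ j, φ j (antiVec (Φ j.1) (1 : G)) = 0) :
    Module.finrank ℚ (antiSpan G (sigmaType (E := fun _ : I => X) Φ)) = T.card * Module.finrank ℚ A := by
  have hU : ∀ i, antiSpan G (Φ i) = A := fun i => antiSpan_eq_of_irreducible hAst hirr (hu i)
  rw [finrank_antiSpan_sigmaType_eq_sum_of_maximal (E := fun _ : I => X) Φ T
    (fun i _ => by rw [hU i]; exact hirr)
    ((forall_map_slotExt_le_subtype_iff_forall_equivariant hAst hirr Φ hu (· ∈ T)).2 hind)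
    (fun i₀ hi₀ hadd => hmax i₀ hi₀
      ((forall_map_slotExt_le_subtype_iff_forall_equivariant hAst hirr Φ hu fun i => i ∈ T ∨ i = i₀).1 hadd)),
    Finset.sum_congr rfl fun i _ => by rw [hU i], Finset.sum_const, smul_eq_mul]

omit [Nonempty X] in
/-- **Maximal independent sets of slots exist.** [cite: Serre1977, §2.2 Prop. 4] -/
theorem exists_maximal_independent
    (hAst : ∀ (k : G) (a : X → ℚ), a ∈ A → (fun x => a (k • x)) ∈ A)
    (hirr : ∀ W : Submodule ℚ (X → ℚ), W ≤ A → W ≠ ⊥ →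
      (∀ (k : G) (f : X → ℚ), f ∈ W → (fun y => f (k • y)) ∈ W) → W = A)
    (Φ : I → Set X) (hu : ∀ i, antiVec (Φ i) (1 : G) ∈ A) :
    ∃ T : Finset I,
      (∀ φ : {i // i ∈ T} → ((X → ℚ) →ₗ[ℚ] (X → ℚ)),
        (∀ j (g : G) (f : X → ℚ), φ j (fun x => f (g⁻¹ • x)) = fun x => φ j f (g⁻¹ • x)) →
        ∑ j, φ j (antiVec (Φ j.1) (1 : G)) = 0 → ∀ j, φ j (antiVec (Φ j.1) (1 : G)) = 0) ∧
      ∀ i₀, i₀ ∉ T → ¬ ∀ φ : {i // i ∈ T ∨ i = i₀} → ((X → ℚ) →ₗ[ℚ] (X → ℚ)),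
        (∀ j (g : G) (f : X → ℚ), φ j (fun x => f (g⁻¹ • x)) = fun x => φ j f (g⁻¹ • x)) →
        ∑ j, φ j (antiVec (Φ j.1) (1 : G)) = 0 → ∀ j, φ j (antiVec (Φ j.1) (1 : G)) = 0 := by
  obtain ⟨T, hadd, hmax⟩ := exists_maximal_forall_map_slotExt_le (G := G) (E := fun _ : I => X) Φ
  exact ⟨T, (forall_map_slotExt_le_subtype_iff_forall_equivariant hAst hirr Φ hu (· ∈ T)).1 hadd,
    fun i₀ hi₀ hind => hmax i₀ hi₀
      ((forall_map_slotExt_le_subtype_iff_forall_equivariant hAst hirr Φ hu fun i => i ∈ T ∨ i = i₀).2 hind)⟩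

/-- **`dim U(Σ) = t · dim A` with `t` the size of a maximal independent set of slots** — seat gen 55's
`exists_finrank_antiSpan_sigmaType_eq_mul` with the multiplier identified. [cite: Mai1989, §2 Prop. 1 (proof)]
[cite: Gordon1999HodgeAVSurvey, §3 Theorem (proof) and 7.5–7.7] -/
theorem exists_maximal_finrank_antiSpan_sigmaType_eq_card_mul
    (hAst : ∀ (k : G) (a : X → ℚ), a ∈ A → (fun x => a (k • x)) ∈ A)
    (hirr : ∀ W : Submodule ℚ (X → ℚ), W ≤ A → W ≠ ⊥ →
      (∀ (k : G) (f : X → ℚ), f ∈ W → (fun y => f (k • y)) ∈ W) → W = A)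
    (Φ : I → Set X) (hu : ∀ i, antiVec (Φ i) (1 : G) ∈ A) :
    ∃ T : Finset I,
      (∀ φ : {i // i ∈ T} → ((X → ℚ) →ₗ[ℚ] (X → ℚ)),
        (∀ j (g : G) (f : X → ℚ), φ j (fun x => f (g⁻¹ • x)) = fun x => φ j f (g⁻¹ • x)) →
        ∑ j, φ j (antiVec (Φ j.1) (1 : G)) = 0 → ∀ j, φ j (antiVec (Φ j.1) (1 : G)) = 0) ∧
      (∀ i₀, i₀ ∉ T → ¬ ∀ φ : {i // i ∈ T ∨ i = i₀} → ((X → ℚ) →ₗ[ℚ] (X → ℚ)),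
        (∀ j (g : G) (f : X → ℚ), φ j (fun x => f (g⁻¹ • x)) = fun x => φ j f (g⁻¹ • x)) →
        ∑ j, φ j (antiVec (Φ j.1) (1 : G)) = 0 → ∀ j, φ j (antiVec (Φ j.1) (1 : G)) = 0) ∧
      Module.finrank ℚ (antiSpan G (sigmaType (E := fun _ : I => X) Φ)) = T.card * Module.finrank ℚ A := by
  obtain ⟨T, hind, hmax⟩ := exists_maximal_independent hAst hirr Φ hu
  exact ⟨T, hind, hmax, finrank_antiSpan_sigmaType_eq_card_mul_of_maximal hAst hirr Φ hu T hind hmax⟩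

end DRank

/-! ### §3 The multiplier is the `D`-rank: independent sets are small, generating sets are large -/

section Rank

variable [DecidableEq I] [Fintype I] [Fintype X] [Nonempty X] {A : Submodule ℚ (X → ℚ)}

omit [Fintype I] in
/-- **An independent set of slots `S` has `dim U(Σ|_S) = |S| · dim A`** (additive, every member `= A`).
[cite: Mai1989, §2 Prop. 1 (proof)] [cite: Serre1977, §2.2 Prop. 4] -/
theorem finrank_antiSpan_sigmaType_subtype_eq_card_mul_of_independent
    (hAst : ∀ (k : G) (a : X → ℚ), a ∈ A → (fun x => a (k • x)) ∈ A)
    (hirr : ∀ W : Submodule ℚ (X → ℚ), W ≤ A → W ≠ ⊥ →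
      (∀ (k : G) (f : X → ℚ), f ∈ W → (fun y => f (k • y)) ∈ W) → W = A)
    (Φ : I → Set X) (hu : ∀ i, antiVec (Φ i) (1 : G) ∈ A) (S : Finset I)
    (hind : ∀ φ : {i // i ∈ S} → ((X → ℚ) →ₗ[ℚ] (X → ℚ)),
      (∀ j (g : G) (f : X → ℚ), φ j (fun x => f (g⁻¹ • x)) = fun x => φ j f (g⁻¹ • x)) →
      ∑ j, φ j (antiVec (Φ j.1) (1 : G)) = 0 → ∀ j, φ j (antiVec (Φ j.1) (1 : G)) = 0) :
    Module.finrank ℚ (antiSpan G (sigmaType (E := fun _ : {i // i ∈ S} => X) fun j => Φ j.1)) =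
      S.card * Module.finrank ℚ A := by
  have hU : ∀ i, antiSpan G (Φ i) = A := fun i => antiSpan_eq_of_irreducible hAst hirr (hu i)
  rw [(forall_map_slotExt_le_iff_finrank_antiSpan_sigmaType_eq (E := fun _ : {i // i ∈ S} => X)
      fun j => Φ j.1).1 ((forall_map_slotExt_le_subtype_iff_forall_equivariant hAst hirr Φ hu (· ∈ S)).2 hind),
    Finset.sum_congr rfl fun j _ => by rw [hU j.1], Finset.sum_const, smul_eq_mul, Finset.card_univ,
    Fintype.card_coe]

/-- **Independent sets are small: `|S| · dim A ≤ dim U(Σ)`** for every independent set of slots `S` (F1: the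
restriction to `S` is onto). [cite: Mai1989, §2 Prop. 1 (proof)] [cite: Gordon1999HodgeAVSurvey, §3 Theorem (proof)] -/
theorem card_mul_finrank_le_of_independent
    (hAst : ∀ (k : G) (a : X → ℚ), a ∈ A → (fun x => a (k • x)) ∈ A)
    (hirr : ∀ W : Submodule ℚ (X → ℚ), W ≤ A → W ≠ ⊥ →
      (∀ (k : G) (f : X → ℚ), f ∈ W → (fun y => f (k • y)) ∈ W) → W = A)
    (Φ : I → Set X) (hu : ∀ i, antiVec (Φ i) (1 : G) ∈ A) (S : Finset I)
    (hind : ∀ φ : {i // i ∈ S} → ((X → ℚ) →ₗ[ℚ] (X → ℚ)),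
      (∀ j (g : G) (f : X → ℚ), φ j (fun x => f (g⁻¹ • x)) = fun x => φ j f (g⁻¹ • x)) →
      ∑ j, φ j (antiVec (Φ j.1) (1 : G)) = 0 → ∀ j, φ j (antiVec (Φ j.1) (1 : G)) = 0) :
    S.card * Module.finrank ℚ A ≤ Module.finrank ℚ (antiSpan G (sigmaType (E := fun _ : I => X) Φ)) := by
  rw [← finrank_antiSpan_sigmaType_subtype_eq_card_mul_of_independent hAst hirr Φ hu S hind]
  exact finrank_antiSpan_sigmaType_reindex_le (E := fun _ : I => X) Φ (Subtype.val : {i // i ∈ S} → I)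

omit [DecidableEq I] in
/-- **Generating sets are large: `dim U(Σ) ≤ |S| · dim A`** for every set of slots `S` through which ALL type
vectors are equivariant combinations `u_i = Σ_{j∈S} φ_ij(u_j)` (F1: the restriction to `S` is then injective on
`U(Σ)`, and `dim U(Σ|_S) ≤ Σ_{S} dim A`). [cite: Mai1989, §2 Prop. 1 (proof)] [cite: Gordon1999HodgeAVSurvey, §3 Theorem (proof)] -/
theorem finrank_le_card_mul_of_generated
    (hAst : ∀ (k : G) (a : X → ℚ), a ∈ A → (fun x => a (k • x)) ∈ A)
    (hirr : ∀ W : Submodule ℚ (X → ℚ), W ≤ A → W ≠ ⊥ →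
      (∀ (k : G) (f : X → ℚ), f ∈ W → (fun y => f (k • y)) ∈ W) → W = A)
    (Φ : I → Set X) (hu : ∀ i, antiVec (Φ i) (1 : G) ∈ A) (S : Finset I)
    (φ : I → {i // i ∈ S} → ((X → ℚ) →ₗ[ℚ] (X → ℚ)))
    (hφ : ∀ i j (g : G) (f : X → ℚ), φ i j (fun y => f (g • y)) = fun z => φ i j f (g • z))
    (hgen : ∀ i, antiVec (Φ i) (1 : G) = ∑ j, φ i j (antiVec (Φ j.1) (1 : G))) :
    Module.finrank ℚ (antiSpan G (sigmaType (E := fun _ : I => X) Φ)) ≤ S.card * Module.finrank ℚ A := by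
  have hU : ∀ i, antiSpan G (Φ i) = A := fun i => antiSpan_eq_of_irreducible hAst hirr (hu i)
  rw [finrank_antiSpan_sigmaType_eq_reindex_of_generated (E := fun _ : I => X) Φ
    (Subtype.val : {i // i ∈ S} → I) φ hφ hgen]
  calc Module.finrank ℚ (antiSpan G (sigmaType (E := fun _ : {i // i ∈ S} => X) fun j => Φ j.1))
      ≤ ∑ j : {i // i ∈ S}, Module.finrank ℚ (antiSpan G (Φ j.1)) :=
        finrank_antiSpan_sigmaType_le (E := fun _ : {i // i ∈ S} => X) fun j => Φ j.1
    _ = S.card * Module.finrank ℚ A := by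
        rw [Finset.sum_congr rfl fun j _ => by rw [hU j.1], Finset.sum_const, smul_eq_mul, Finset.card_univ,
          Fintype.card_coe]

/-- `dim A > 0` as soon as a type vector lies in `A` (`u_1(Φ) ≠ 0`). [folklore] -/
theorem finrank_pos_of_antiVec_mem (Φ : Set X) (hu : antiVec Φ (1 : G) ∈ A) : 0 < Module.finrank ℚ A := by
  rw [Module.finrank_pos_iff_exists_ne_zero]
  exact ⟨⟨antiVec Φ (1 : G), hu⟩, fun h => antiVec_one_ne_zero (G := G) Φ (congrArg Subtype.val h)⟩

/-- **Every independent set of slots is at most as large as any maximal one** (`|S| ≤ |T|`).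
[cite: Serre1977, §2.2 Prop. 4] [cite: Mai1989, §2 Prop. 1 (proof)] -/
theorem card_le_card_of_independent_of_maximal [Nonempty I]
    (hAst : ∀ (k : G) (a : X → ℚ), a ∈ A → (fun x => a (k • x)) ∈ A)
    (hirr : ∀ W : Submodule ℚ (X → ℚ), W ≤ A → W ≠ ⊥ →
      (∀ (k : G) (f : X → ℚ), f ∈ W → (fun y => f (k • y)) ∈ W) → W = A)
    (Φ : I → Set X) (hu : ∀ i, antiVec (Φ i) (1 : G) ∈ A) (S T : Finset I)
    (hS : ∀ φ : {i // i ∈ S} → ((X → ℚ) →ₗ[ℚ] (X → ℚ)),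
      (∀ j (g : G) (f : X → ℚ), φ j (fun x => f (g⁻¹ • x)) = fun x => φ j f (g⁻¹ • x)) →
      ∑ j, φ j (antiVec (Φ j.1) (1 : G)) = 0 → ∀ j, φ j (antiVec (Φ j.1) (1 : G)) = 0)
    (hT : ∀ φ : {i // i ∈ T} → ((X → ℚ) →ₗ[ℚ] (X → ℚ)),
      (∀ j (g : G) (f : X → ℚ), φ j (fun x => f (g⁻¹ • x)) = fun x => φ j f (g⁻¹ • x)) →
      ∑ j, φ j (antiVec (Φ j.1) (1 : G)) = 0 → ∀ j, φ j (antiVec (Φ j.1) (1 : G)) = 0)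
    (hTmax : ∀ i₀, i₀ ∉ T → ¬ ∀ φ : {i // i ∈ T ∨ i = i₀} → ((X → ℚ) →ₗ[ℚ] (X → ℚ)),
      (∀ j (g : G) (f : X → ℚ), φ j (fun x => f (g⁻¹ • x)) = fun x => φ j f (g⁻¹ • x)) →
      ∑ j, φ j (antiVec (Φ j.1) (1 : G)) = 0 → ∀ j, φ j (antiVec (Φ j.1) (1 : G)) = 0) :
    S.card ≤ T.card := by
  have h := card_mul_finrank_le_of_independent hAst hirr Φ hu S hS
  rw [finrank_antiSpan_sigmaType_eq_card_mul_of_maximal hAst hirr Φ hu T hT hTmax] at h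
  exact Nat.le_of_mul_le_mul_right h (finrank_pos_of_antiVec_mem (Φ (Classical.arbitrary I)) (hu _))

/-- **All maximal independent sets of slots have the same size** (the `D`-rank `t`).
[cite: Serre1977, §2.2 Prop. 4] [cite: Mai1989, §2 Prop. 1 (proof)] -/
theorem card_eq_card_of_maximal [Nonempty I]
    (hAst : ∀ (k : G) (a : X → ℚ), a ∈ A → (fun x => a (k • x)) ∈ A)
    (hirr : ∀ W : Submodule ℚ (X → ℚ), W ≤ A → W ≠ ⊥ →
      (∀ (k : G) (f : X → ℚ), f ∈ W → (fun y => f (k • y)) ∈ W) → W = A)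
    (Φ : I → Set X) (hu : ∀ i, antiVec (Φ i) (1 : G) ∈ A) (S T : Finset I)
    (hS : ∀ φ : {i // i ∈ S} → ((X → ℚ) →ₗ[ℚ] (X → ℚ)),
      (∀ j (g : G) (f : X → ℚ), φ j (fun x => f (g⁻¹ • x)) = fun x => φ j f (g⁻¹ • x)) →
      ∑ j, φ j (antiVec (Φ j.1) (1 : G)) = 0 → ∀ j, φ j (antiVec (Φ j.1) (1 : G)) = 0)
    (hSmax : ∀ i₀, i₀ ∉ S → ¬ ∀ φ : {i // i ∈ S ∨ i = i₀} → ((X → ℚ) →ₗ[ℚ] (X → ℚ)),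
      (∀ j (g : G) (f : X → ℚ), φ j (fun x => f (g⁻¹ • x)) = fun x => φ j f (g⁻¹ • x)) →
      ∑ j, φ j (antiVec (Φ j.1) (1 : G)) = 0 → ∀ j, φ j (antiVec (Φ j.1) (1 : G)) = 0)
    (hT : ∀ φ : {i // i ∈ T} → ((X → ℚ) →ₗ[ℚ] (X → ℚ)),
      (∀ j (g : G) (f : X → ℚ), φ j (fun x => f (g⁻¹ • x)) = fun x => φ j f (g⁻¹ • x)) →
      ∑ j, φ j (antiVec (Φ j.1) (1 : G)) = 0 → ∀ j, φ j (antiVec (Φ j.1) (1 : G)) = 0)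
    (hTmax : ∀ i₀, i₀ ∉ T → ¬ ∀ φ : {i // i ∈ T ∨ i = i₀} → ((X → ℚ) →ₗ[ℚ] (X → ℚ)),
      (∀ j (g : G) (f : X → ℚ), φ j (fun x => f (g⁻¹ • x)) = fun x => φ j f (g⁻¹ • x)) →
      ∑ j, φ j (antiVec (Φ j.1) (1 : G)) = 0 → ∀ j, φ j (antiVec (Φ j.1) (1 : G)) = 0) :
    S.card = T.card :=
  le_antisymm (card_le_card_of_independent_of_maximal hAst hirr Φ hu S T hS hT hTmax)
    (card_le_card_of_independent_of_maximal hAst hirr Φ hu T S hT hS hSmax)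

/-- **Every generating set of slots is at least as large as any maximal independent one** (`|T| ≤ |S|`): the
maximal independent sets realise the minimum number of members through which all type vectors are equivariant
combinations. [cite: Serre1977, §2.2 Prop. 4] [cite: Mai1989, §2 Prop. 1 (proof)] -/
theorem card_le_card_of_generated [Nonempty I]
    (hAst : ∀ (k : G) (a : X → ℚ), a ∈ A → (fun x => a (k • x)) ∈ A)
    (hirr : ∀ W : Submodule ℚ (X → ℚ), W ≤ A → W ≠ ⊥ →
      (∀ (k : G) (f : X → ℚ), f ∈ W → (fun y => f (k • y)) ∈ W) → W = A)
    (Φ : I → Set X) (hu : ∀ i, antiVec (Φ i) (1 : G) ∈ A) (T S : Finset I)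
    (hT : ∀ φ : {i // i ∈ T} → ((X → ℚ) →ₗ[ℚ] (X → ℚ)),
      (∀ j (g : G) (f : X → ℚ), φ j (fun x => f (g⁻¹ • x)) = fun x => φ j f (g⁻¹ • x)) →
      ∑ j, φ j (antiVec (Φ j.1) (1 : G)) = 0 → ∀ j, φ j (antiVec (Φ j.1) (1 : G)) = 0)
    (hTmax : ∀ i₀, i₀ ∉ T → ¬ ∀ φ : {i // i ∈ T ∨ i = i₀} → ((X → ℚ) →ₗ[ℚ] (X → ℚ)),
      (∀ j (g : G) (f : X → ℚ), φ j (fun x => f (g⁻¹ • x)) = fun x => φ j f (g⁻¹ • x)) →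
      ∑ j, φ j (antiVec (Φ j.1) (1 : G)) = 0 → ∀ j, φ j (antiVec (Φ j.1) (1 : G)) = 0)
    (φ : I → {i // i ∈ S} → ((X → ℚ) →ₗ[ℚ] (X → ℚ)))
    (hφ : ∀ i j (g : G) (f : X → ℚ), φ i j (fun y => f (g • y)) = fun z => φ i j f (g • z))
    (hgen : ∀ i, antiVec (Φ i) (1 : G) = ∑ j, φ i j (antiVec (Φ j.1) (1 : G))) :
    T.card ≤ S.card := by
  have h := finrank_le_card_mul_of_generated hAst hirr Φ hu S φ hφ hgen
  rw [finrank_antiSpan_sigmaType_eq_card_mul_of_maximal hAst hirr Φ hu T hT hTmax] at h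
  exact Nat.le_of_mul_le_mul_right h (finrank_pos_of_antiVec_mem (Φ (Classical.arbitrary I)) (hu _))

/-- **A maximal independent set GENERATES**: every type vector is an equivariant combination of those indexed by
`T` (F1 §3 on the isomorphism `U(Σ) ≅ U(Σ|_T)`). [cite: Serre1977, §1.3 Thm. 1 and §2.2 Prop. 4] -/
theorem exists_generated_of_maximal
    (hAst : ∀ (k : G) (a : X → ℚ), a ∈ A → (fun x => a (k • x)) ∈ A)
    (hirr : ∀ W : Submodule ℚ (X → ℚ), W ≤ A → W ≠ ⊥ →
      (∀ (k : G) (f : X → ℚ), f ∈ W → (fun y => f (k • y)) ∈ W) → W = A)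
    (Φ : I → Set X) (hu : ∀ i, antiVec (Φ i) (1 : G) ∈ A) (T : Finset I)
    (hT : ∀ φ : {i // i ∈ T} → ((X → ℚ) →ₗ[ℚ] (X → ℚ)),
      (∀ j (g : G) (f : X → ℚ), φ j (fun x => f (g⁻¹ • x)) = fun x => φ j f (g⁻¹ • x)) →
      ∑ j, φ j (antiVec (Φ j.1) (1 : G)) = 0 → ∀ j, φ j (antiVec (Φ j.1) (1 : G)) = 0)
    (hTmax : ∀ i₀, i₀ ∉ T → ¬ ∀ φ : {i // i ∈ T ∨ i = i₀} → ((X → ℚ) →ₗ[ℚ] (X → ℚ)),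
      (∀ j (g : G) (f : X → ℚ), φ j (fun x => f (g⁻¹ • x)) = fun x => φ j f (g⁻¹ • x)) →
      ∑ j, φ j (antiVec (Φ j.1) (1 : G)) = 0 → ∀ j, φ j (antiVec (Φ j.1) (1 : G)) = 0) :
    ∃ φ : I → {i // i ∈ T} → ((X → ℚ) →ₗ[ℚ] (X → ℚ)),
      (∀ i j (g : G) (f : X → ℚ), φ i j (fun y => f (g • y)) = fun z => φ i j f (g • z)) ∧
      ∀ i, antiVec (Φ i) (1 : G) = ∑ j, φ i j (antiVec (Φ j.1) (1 : G)) := by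
  refine exists_generated_of_finrank_antiSpan_sigmaType_eq_reindex (E := fun _ : I => X) Φ
    (Subtype.val : {i // i ∈ T} → I) ?_
  rw [finrank_antiSpan_sigmaType_eq_card_mul_of_maximal hAst hirr Φ hu T hT hTmax,
    finrank_antiSpan_sigmaType_subtype_eq_card_mul_of_independent hAst hirr Φ hu T hT]

end Rank

/-! ### §4 CM types of an (IRR) slot: `rank(Σ) = t·n + 1` -/

section CMTypes

variable [DecidableEq I] [Fintype I] [Fintype X] [Nonempty X] [Nonempty I] {ρ : G}

/-- **CM types of an (IRR) slot (`|X| = 2n`): `rank(Σ) = |T|·n + 1` for every maximal independent set of slots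
`T`** — `dim Hg(A_1 × ⋯ × A_k) = n·t` for abelian varieties with CM by one (IRR) field, `t` = the largest number of
them forming a nondegenerate family. [cite: Mai1989, §2 Prop. 1 (proof)]
[cite: Gordon1999HodgeAVSurvey, §3 Theorem (proof), 7.5–7.7] -/
theorem typeRank_sigmaType_eq_card_mul_add_one_of_maximal (Φ : I → Set X) (h : ∀ i, IsCMTypeWith ρ (Φ i))
    (hirr : ∀ W : Submodule ℚ (X → ℚ), W ≤ antiWeights (E := X) ρ → W ≠ ⊥ →
      (∀ (k : G) (f : X → ℚ), f ∈ W → (fun y => f (k • y)) ∈ W) → W = antiWeights (E := X) ρ)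
    (T : Finset I)
    (hT : ∀ φ : {i // i ∈ T} → ((X → ℚ) →ₗ[ℚ] (X → ℚ)),
      (∀ j (g : G) (f : X → ℚ), φ j (fun x => f (g⁻¹ • x)) = fun x => φ j f (g⁻¹ • x)) →
      ∑ j, φ j (antiVec (Φ j.1) (1 : G)) = 0 → ∀ j, φ j (antiVec (Φ j.1) (1 : G)) = 0)
    (hTmax : ∀ i₀, i₀ ∉ T → ¬ ∀ φ : {i // i ∈ T ∨ i = i₀} → ((X → ℚ) →ₗ[ℚ] (X → ℚ)),
      (∀ j (g : G) (f : X → ℚ), φ j (fun x => f (g⁻¹ • x)) = fun x => φ j f (g⁻¹ • x)) →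
      ∑ j, φ j (antiVec (Φ j.1) (1 : G)) = 0 → ∀ j, φ j (antiVec (Φ j.1) (1 : G)) = 0) :
    typeRank G (sigmaType (E := fun _ : I => X) Φ) = T.card * (Fintype.card X / 2) + 1 := by
  have i₀ := Classical.arbitrary I
  haveI : Nonempty (Σ _ : I, X) := ⟨⟨i₀, Classical.arbitrary X⟩⟩
  rw [(IsCMTypeWith.sigmaType (E := fun _ : I => X) h).typeRank_eq_finrank_antiSpan_add_one,
    finrank_antiSpan_sigmaType_eq_card_mul_of_maximal (comp_smul_mem_antiWeights (h i₀).comm) hirr Φ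
      (fun i => antiVec_mem_antiWeights (h i) 1) T hT hTmax,
    finrank_antiWeights_eq_of_typeRank_eq (h i₀) (typeRank_eq_of_irreducible (h i₀) hirr)]

omit [Fintype I] in
/-- **… and `rank(Σ) = rank(Σ|_T)`**: the sub-family `T` already has the rank of the whole family (and is itself
nondegenerate as a same-slot family: `rank(Σ|_T) = |T|·n + 1`). [cite: Gordon1999HodgeAVSurvey, 7.5–7.7] -/
theorem typeRank_sigmaType_subtype_eq_card_mul_add_one_of_independent (Φ : I → Set X)
    (h : ∀ i, IsCMTypeWith ρ (Φ i))
    (hirr : ∀ W : Submodule ℚ (X → ℚ), W ≤ antiWeights (E := X) ρ → W ≠ ⊥ →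
      (∀ (k : G) (f : X → ℚ), f ∈ W → (fun y => f (k • y)) ∈ W) → W = antiWeights (E := X) ρ)
    (T : Finset I) (hTne : T.Nonempty)
    (hT : ∀ φ : {i // i ∈ T} → ((X → ℚ) →ₗ[ℚ] (X → ℚ)),
      (∀ j (g : G) (f : X → ℚ), φ j (fun x => f (g⁻¹ • x)) = fun x => φ j f (g⁻¹ • x)) →
      ∑ j, φ j (antiVec (Φ j.1) (1 : G)) = 0 → ∀ j, φ j (antiVec (Φ j.1) (1 : G)) = 0) :
    typeRank G (sigmaType (E := fun _ : {i // i ∈ T} => X) fun j => Φ j.1) =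
      T.card * (Fintype.card X / 2) + 1 := by
  have i₀ := Classical.arbitrary I
  obtain ⟨j₀, hj₀⟩ := hTne
  haveI : Nonempty (Σ _ : {i // i ∈ T}, X) := ⟨⟨⟨j₀, hj₀⟩, Classical.arbitrary X⟩⟩
  rw [(IsCMTypeWith.sigmaType (E := fun _ : {i // i ∈ T} => X) fun j => h j.1).typeRank_eq_finrank_antiSpan_add_one,
    finrank_antiSpan_sigmaType_subtype_eq_card_mul_of_independent (comp_smul_mem_antiWeights (h i₀).comm) hirr Φ
      (fun i => antiVec_mem_antiWeights (h i) 1) T hT,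
    finrank_antiWeights_eq_of_typeRank_eq (h i₀) (typeRank_eq_of_irreducible (h i₀) hirr)]

end CMTypes

end Summit.HodgeConjecture.CorCM.IrrOdd

end
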